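import Summits.AnomalousDissipation.AnomalousDissipation.Theorems.SawtoothPulseCascadeK1LocalisedCascadeKHKernelBloch
import Mathlib.MeasureTheory.Function.Floor

/-!
# K2 lane (route-2 `SawtoothPulseCascade`, crux dir `K1LocalisedCascade`): the DERIVATIVE of the Bloch line kernel — crude bound for one kernel, POLE-FREE bound for the antisymmetric kink pair

Helper file of the K2 lane (ACL item stmt-AnomalousDissipation-19491; arbiter A28-11, the corner law; sequel of `…KHKernelBloch`).  With
`K'(r) = (e^{−κr}/(1 − z̄q) − z e^{κ(r−1)}/(1 − zq))/2` (hypothesis `hK'`) and its Bloch extension `G'(u) = e^{2πiβ⌊u⌋}K'(u − ⌊u⌋)` (`hG'`):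
* `hasDerivAt_lineKernelK`, `hasDerivAt_blochKernel` — `G` is differentiable off `ℤ` with derivative `G'`;
* `norm_lineKernelK'_le`, `norm_blochKernelDeriv_le` — `‖G'(u)‖ ≤ 1/‖1 − zq‖` (each exponential branch is `O(1/‖1 − zq‖) = O(1/√(a²+β²))`);
* **`norm_blochKernelDeriv_pair_sub_le`** — `‖G'(u+½)e^{−iπβ/2} − G'(u)e^{iπβ/2}‖ ≤ (πa + ‖e^{iπβ} − 1‖)/‖1 − zq‖`: in the antisymmetric kink-pair
  combination every branch appears as a DIFFERENCE of two nearby amplitudes/phases, so the numerator is `O(a + |β|)` and the quotient stays bounded at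
  the corner `(a, β) → 0` (the pole of the kernel never differentiates into the antisymmetric source).
No definitions; no statement about the crux. [cite: Drazin2002, §8.3 (8.36)–(8.38)] [problem: turb]
-/

-- `Summit.<Summit>.<Problem>`: single-conjunct summit, the duplicate namespace segment is deliberate.
set_option linter.dupNamespace false

noncomputable section

namespace Summit.AnomalousDissipation.AnomalousDissipation.Theorems.SawtoothPulseCascade.K2PhaseBudget

open Set MeasureTheory intervalIntegral Literature.Analysis.FluidPDE.SawtoothCascade

section kernelDeriv

variable {a β : ℝ} {K G : ℝ → ℂ}

/-! ## §1 The derivative of the Bloch kernel off the lattice -/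

/-- The closed form is differentiable: `K'(r) = (e^{−κr}/(1 − z̄q) − z e^{κ(r−1)}/(1 − zq))/2`. [cite: Drazin2002, §8.3 (8.36)–(8.38)] -/
theorem hasDerivAt_lineKernelK (ha : 0 < a) (β : ℝ)
    (hK : K = fun r : ℝ => (-((Real.exp (-(2 * Real.pi * a * r)) : ℂ) /
            (1 - starRingEnd ℂ (Complex.exp (2 * Real.pi * β * Complex.I)) * (Real.exp (-(2 * Real.pi * a)) : ℂ))
          + (Real.exp (2 * Real.pi * a * (r - 1)) : ℂ) * Complex.exp (2 * Real.pi * β * Complex.I) /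
            (1 - Complex.exp (2 * Real.pi * β * Complex.I) * (Real.exp (-(2 * Real.pi * a)) : ℂ))) /
        (2 * (2 * Real.pi * a) : ℂ)))
    {K' : ℝ → ℂ}
    (hK' : K' = fun r : ℝ => ((Real.exp (-(2 * Real.pi * a * r)) : ℂ) /
            (1 - starRingEnd ℂ (Complex.exp (2 * Real.pi * β * Complex.I)) * (Real.exp (-(2 * Real.pi * a)) : ℂ))
          - (Real.exp (2 * Real.pi * a * (r - 1)) : ℂ) * Complex.exp (2 * Real.pi * β * Complex.I) /
            (1 - Complex.exp (2 * Real.pi * β * Complex.I) * (Real.exp (-(2 * Real.pi * a)) : ℂ))) / 2) (r : ℝ) :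
    HasDerivAt K (K' r) r := by
  set z : ℂ := Complex.exp (2 * Real.pi * β * Complex.I) with hz
  set D1 : ℂ := 1 - starRingEnd ℂ z * (Real.exp (-(2 * Real.pi * a)) : ℂ) with hD1
  set D2 : ℂ := 1 - z * (Real.exp (-(2 * Real.pi * a)) : ℂ) with hD2
  have hκ : (2 * (2 * Real.pi * a) : ℂ) ≠ 0 := by
    have : (0 : ℝ) < 2 * (2 * Real.pi * a) := by positivity
    exact_mod_cast this.ne'
  have h1 : HasDerivAt (fun x : ℝ => ((Real.exp (-(2 * Real.pi * a * x)) : ℝ) : ℂ))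
      (((Real.exp (-(2 * Real.pi * a * r)) * (-(2 * Real.pi * a * 1)) : ℝ) : ℂ)) r := by
    have h := (((hasDerivAt_id r).const_mul (2 * Real.pi * a)).neg.exp).ofReal_comp
    simpa only [id, Pi.neg_apply] using h
  have h2 : HasDerivAt (fun x : ℝ => ((Real.exp (2 * Real.pi * a * (x - 1)) : ℝ) : ℂ))
      (((Real.exp (2 * Real.pi * a * (r - 1)) * (2 * Real.pi * a * 1) : ℝ) : ℂ)) r := by
    have h := ((((hasDerivAt_id r).sub_const (1 : ℝ)).const_mul (2 * Real.pi * a)).exp).ofReal_comp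
    simpa only [id] using h
  have hd := (((h1.div_const D1).add ((h2.mul_const z).div_const D2)).neg).div_const (2 * (2 * Real.pi * a) : ℂ)
  have hzn : ‖z‖ = 1 := by
    rw [hz, show (2 * Real.pi * β * Complex.I : ℂ) = ((2 * Real.pi * β : ℝ) : ℂ) * Complex.I by push_cast; ring]
    exact Complex.norm_exp_ofReal_mul_I _
  have hq0 : 0 < Real.exp (-(2 * Real.pi * a)) := Real.exp_pos _
  have hq1 : Real.exp (-(2 * Real.pi * a)) < 1 := Real.exp_lt_one_iff.2 (by nlinarith [Real.pi_pos])
  have hd1 : D1 ≠ 0 := one_sub_mul_ne_zero (by rw [Complex.norm_conj]; exact hzn) hq0.le hq1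
  have hd2 : D2 ≠ 0 := one_sub_mul_ne_zero hzn hq0.le hq1
  have ha' : (a : ℂ) ≠ 0 := by exact_mod_cast ha.ne'
  have hπ' : (Real.pi : ℂ) ≠ 0 := by exact_mod_cast Real.pi_pos.ne'
  rw [hK, hK']
  refine hd.congr_deriv ?_
  push_cast
  field_simp
  ring

/-- **The Bloch kernel is differentiable off the lattice `ℤ`**, with derivative `G'(u) = e^{2πiβ⌊u⌋} K'(u − ⌊u⌋)` (the floor is locally constant).
[cite: Drazin2002, §8.3 (8.36)–(8.38)] -/
theorem hasDerivAt_blochKernel (ha : 0 < a) (β : ℝ)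
    (hK : K = fun r : ℝ => (-((Real.exp (-(2 * Real.pi * a * r)) : ℂ) /
            (1 - starRingEnd ℂ (Complex.exp (2 * Real.pi * β * Complex.I)) * (Real.exp (-(2 * Real.pi * a)) : ℂ))
          + (Real.exp (2 * Real.pi * a * (r - 1)) : ℂ) * Complex.exp (2 * Real.pi * β * Complex.I) /
            (1 - Complex.exp (2 * Real.pi * β * Complex.I) * (Real.exp (-(2 * Real.pi * a)) : ℂ))) /
        (2 * (2 * Real.pi * a) : ℂ)))
    (hG : ∀ u : ℝ, G u = Complex.exp (2 * Real.pi * β * (⌊u⌋ : ℝ) * Complex.I) * K (u - ⌊u⌋))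
    {K' G' : ℝ → ℂ}
    (hK' : K' = fun r : ℝ => ((Real.exp (-(2 * Real.pi * a * r)) : ℂ) /
            (1 - starRingEnd ℂ (Complex.exp (2 * Real.pi * β * Complex.I)) * (Real.exp (-(2 * Real.pi * a)) : ℂ))
          - (Real.exp (2 * Real.pi * a * (r - 1)) : ℂ) * Complex.exp (2 * Real.pi * β * Complex.I) /
            (1 - Complex.exp (2 * Real.pi * β * Complex.I) * (Real.exp (-(2 * Real.pi * a)) : ℂ))) / 2)
    (hG' : ∀ u : ℝ, G' u = Complex.exp (2 * Real.pi * β * (⌊u⌋ : ℝ) * Complex.I) * K' (u - ⌊u⌋))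
    {u : ℝ} (hu : Int.fract u ≠ 0) : HasDerivAt G (G' u) u := by
  set n : ℤ := ⌊u⌋ with hn
  have hlo : (n : ℝ) < u := by
    have h0 : 0 < Int.fract u := lt_of_le_of_ne (Int.fract_nonneg u) (Ne.symm hu)
    rw [Int.fract] at h0
    linarith
  have hhi : u < (n : ℝ) + 1 := Int.lt_floor_add_one u
  -- near `u` the floor is `n`
  have hev : G =ᶠ[nhds u] fun v : ℝ => Complex.exp (2 * Real.pi * β * (n : ℝ) * Complex.I) * K (v - n) := by
    filter_upwards [Ioo_mem_nhds hlo hhi] with v hv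
    have hfl : ⌊v⌋ = n := Int.floor_eq_iff.2 ⟨hv.1.le, hv.2⟩
    rw [hG v, hfl]
  have hKd : HasDerivAt (fun v : ℝ => K (v - n)) (K' (u - n)) u :=
    HasDerivAt.comp_sub_const u (n : ℝ) (hasDerivAt_lineKernelK ha β hK hK' (u - n))
  have hd := hKd.const_mul (Complex.exp (2 * Real.pi * β * (n : ℝ) * Complex.I))
  rw [hG' u]
  exact hd.congr_of_eventuallyEq hev

/-- The derivative `G'` of the Bloch kernel is measurable (continuous `K'` composed with `fract`, times a phase of the floor). [folklore] -/
theorem measurable_blochKernelDeriv (a β : ℝ) {K' G' : ℝ → ℂ}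
    (hK' : K' = fun r : ℝ => ((Real.exp (-(2 * Real.pi * a * r)) : ℂ) /
            (1 - starRingEnd ℂ (Complex.exp (2 * Real.pi * β * Complex.I)) * (Real.exp (-(2 * Real.pi * a)) : ℂ))
          - (Real.exp (2 * Real.pi * a * (r - 1)) : ℂ) * Complex.exp (2 * Real.pi * β * Complex.I) /
            (1 - Complex.exp (2 * Real.pi * β * Complex.I) * (Real.exp (-(2 * Real.pi * a)) : ℂ))) / 2)
    (hG' : ∀ u : ℝ, G' u = Complex.exp (2 * Real.pi * β * (⌊u⌋ : ℝ) * Complex.I) * K' (u - ⌊u⌋)) : Measurable G' := by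
  have hK'c : Continuous K' := by rw [hK']; fun_prop
  have hfl : Measurable (fun u : ℝ => ((⌊u⌋ : ℤ) : ℝ)) := measurable_from_top.comp Int.measurable_floor
  have hG'e : G' = fun u : ℝ => Complex.exp (2 * Real.pi * β * ((⌊u⌋ : ℤ) : ℝ) * Complex.I) * K' (Int.fract u) := by
    funext u; rw [hG' u]; rfl
  rw [hG'e]
  refine Measurable.mul ?_ (hK'c.measurable.comp measurable_fract)
  exact Complex.measurable_exp.comp ((measurable_const.mul (Complex.measurable_ofReal.comp hfl)).mul measurable_const)

/-! ## §2 Bounds on the derivative: crude for one kernel, POLE-FREE for the antisymmetric kink pair -/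

/-- `‖1 − z̄q‖ = ‖1 − zq‖`. [folklore] -/
theorem norm_one_sub_conj_mul (z : ℂ) (q : ℝ) : ‖1 - starRingEnd ℂ z * (q : ℂ)‖ = ‖1 - z * (q : ℂ)‖ := by
  rw [← Complex.norm_conj (1 - z * (q : ℂ))]
  simp only [map_sub, map_one, map_mul, Complex.conj_ofReal]

/-- **Crude bound on the derivative of the closed form:** `‖K'(r)‖ ≤ 1/‖1 − zq‖` on `[0,1]`. [cite: Drazin2002, §8.3 (8.36)–(8.38)] -/
theorem norm_lineKernelK'_le (a β : ℝ) {K' : ℝ → ℂ}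
    (hK' : K' = fun r : ℝ => ((Real.exp (-(2 * Real.pi * a * r)) : ℂ) /
            (1 - starRingEnd ℂ (Complex.exp (2 * Real.pi * β * Complex.I)) * (Real.exp (-(2 * Real.pi * a)) : ℂ))
          - (Real.exp (2 * Real.pi * a * (r - 1)) : ℂ) * Complex.exp (2 * Real.pi * β * Complex.I) /
            (1 - Complex.exp (2 * Real.pi * β * Complex.I) * (Real.exp (-(2 * Real.pi * a)) : ℂ))) / 2)
    (ha : 0 ≤ a) {r : ℝ} (hr0 : 0 ≤ r) (hr1 : r ≤ 1) :
    ‖K' r‖ ≤ 1 / ‖1 - Complex.exp (2 * Real.pi * β * Complex.I) * (Real.exp (-(2 * Real.pi * a)) : ℂ)‖ := by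
  set z : ℂ := Complex.exp (2 * Real.pi * β * Complex.I) with hz
  set N₁ : ℝ := ‖1 - z * (Real.exp (-(2 * Real.pi * a)) : ℂ)‖ with hN₁
  have hzn : ‖z‖ = 1 := by
    rw [hz, show (2 * Real.pi * β * Complex.I : ℂ) = ((2 * Real.pi * β : ℝ) : ℂ) * Complex.I by push_cast; ring]
    exact Complex.norm_exp_ofReal_mul_I _
  have hD1 : ‖1 - starRingEnd ℂ z * (Real.exp (-(2 * Real.pi * a)) : ℂ)‖ = N₁ := norm_one_sub_conj_mul z _
  have hE1 : ‖((Real.exp (-(2 * Real.pi * a * r)) : ℝ) : ℂ)‖ ≤ 1 := by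
    rw [Complex.norm_real, Real.norm_eq_abs, abs_of_pos (Real.exp_pos _), Real.exp_le_one_iff]
    have : 0 ≤ 2 * Real.pi * a * r := by positivity
    linarith
  have hE2 : ‖((Real.exp (2 * Real.pi * a * (r - 1)) : ℝ) : ℂ)‖ ≤ 1 := by
    rw [Complex.norm_real, Real.norm_eq_abs, abs_of_pos (Real.exp_pos _), Real.exp_le_one_iff]
    have h1r : 0 ≤ 1 - r := by linarith
    have : 0 ≤ 2 * Real.pi * a * (1 - r) := by have := Real.pi_pos; positivity
    linarith
  have hN0 : 0 ≤ N₁ := norm_nonneg _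
  rw [hK']
  dsimp only
  rw [norm_div, show ‖(2 : ℂ)‖ = 2 by norm_num]
  have hA : ‖((Real.exp (-(2 * Real.pi * a * r)) : ℝ) : ℂ) / (1 - starRingEnd ℂ z * (Real.exp (-(2 * Real.pi * a)) : ℂ))‖ ≤ 1 / N₁ := by
    rw [norm_div, hD1]
    exact div_le_div_of_nonneg_right hE1 hN0
  have hB : ‖((Real.exp (2 * Real.pi * a * (r - 1)) : ℝ) : ℂ) * z / (1 - z * (Real.exp (-(2 * Real.pi * a)) : ℂ))‖ ≤ 1 / N₁ := by
    rw [norm_div, norm_mul, hzn, mul_one]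
    exact div_le_div_of_nonneg_right hE2 hN0
  calc ‖((Real.exp (-(2 * Real.pi * a * r)) : ℝ) : ℂ) / (1 - starRingEnd ℂ z * (Real.exp (-(2 * Real.pi * a)) : ℂ)) -
          ((Real.exp (2 * Real.pi * a * (r - 1)) : ℝ) : ℂ) * z / (1 - z * (Real.exp (-(2 * Real.pi * a)) : ℂ))‖ / 2
      ≤ (1 / N₁ + 1 / N₁) / 2 := by gcongr; exact (norm_sub_le _ _).trans (add_le_add hA hB)
    _ = 1 / N₁ := by ring

/-- **Crude bound on the derivative of the Bloch kernel:** `‖G'(u)‖ ≤ 1/‖1 − zq‖` for every real `u`. [cite: Drazin2002, §8.3 (8.36)–(8.38)] -/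
theorem norm_blochKernelDeriv_le (ha : 0 < a) (β : ℝ) {K' G' : ℝ → ℂ}
    (hK' : K' = fun r : ℝ => ((Real.exp (-(2 * Real.pi * a * r)) : ℂ) /
            (1 - starRingEnd ℂ (Complex.exp (2 * Real.pi * β * Complex.I)) * (Real.exp (-(2 * Real.pi * a)) : ℂ))
          - (Real.exp (2 * Real.pi * a * (r - 1)) : ℂ) * Complex.exp (2 * Real.pi * β * Complex.I) /
            (1 - Complex.exp (2 * Real.pi * β * Complex.I) * (Real.exp (-(2 * Real.pi * a)) : ℂ))) / 2)
    (hG' : ∀ u : ℝ, G' u = Complex.exp (2 * Real.pi * β * (⌊u⌋ : ℝ) * Complex.I) * K' (u - ⌊u⌋)) (u : ℝ) :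
    ‖G' u‖ ≤ 1 / ‖1 - Complex.exp (2 * Real.pi * β * Complex.I) * (Real.exp (-(2 * Real.pi * a)) : ℂ)‖ := by
  have hr0 : 0 ≤ u - ⌊u⌋ := by linarith [Int.floor_le u]
  have hr1 : u - ⌊u⌋ ≤ 1 := by linarith [Int.lt_floor_add_one u]
  rw [hG' u, norm_mul, show (2 * Real.pi * β * (⌊u⌋ : ℝ) * Complex.I : ℂ) = ((2 * Real.pi * β * ⌊u⌋ : ℝ) : ℂ) * Complex.I by push_cast; ring,
    Complex.norm_exp_ofReal_mul_I, one_mul]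
  exact norm_lineKernelK'_le a β hK' ha.le hr0 hr1

/-- The two elementary differences behind the pole cancellation: for `0 ≤ t ≤ 1`, `κ ≥ 0` and unit vectors `e₁, e₂`,
`‖c·t·e₁ − c·e₂‖`-type bounds reduce to `(1 − e^{−κ/2}) + ‖e₁ − e₂‖`.  Concretely: `‖x·e₁ − e₂‖ ≤ (1 − x) + ‖e₁ − e₂‖` for `x ≤ 1`, `‖e₁‖ = 1`. [folklore] -/
theorem norm_smul_unit_sub_le {x : ℝ} (hx1 : x ≤ 1) {e₁ e₂ : ℂ} (he₁ : ‖e₁‖ = 1) :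
    ‖(x : ℂ) * e₁ - e₂‖ ≤ (1 - x) + ‖e₁ - e₂‖ := by
  have h : (x : ℂ) * e₁ - e₂ = ((x : ℂ) - 1) * e₁ + (e₁ - e₂) := by ring
  rw [h]
  refine (norm_add_le _ _).trans (add_le_add (le_of_eq ?_) le_rfl)
  rw [norm_mul, he₁, mul_one, show ((x : ℂ) - 1) = (((x - 1 : ℝ)) : ℂ) by push_cast; ring, Complex.norm_real, Real.norm_eq_abs,
    abs_of_nonpos (by linarith)]
  ring

/-- `‖e₁ − x·e₂‖ ≤ (1 − x) + ‖e₁ − e₂‖` for `x ≤ 1`, `‖e₂‖ = 1`. [folklore] -/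
theorem norm_unit_sub_smul_le {x : ℝ} (hx1 : x ≤ 1) {e₁ e₂ : ℂ} (he₂ : ‖e₂‖ = 1) :
    ‖e₁ - (x : ℂ) * e₂‖ ≤ (1 - x) + ‖e₁ - e₂‖ := by
  have h : e₁ - (x : ℂ) * e₂ = (1 - (x : ℂ)) * e₂ + (e₁ - e₂) := by ring
  rw [h]
  refine (norm_add_le _ _).trans (add_le_add (le_of_eq ?_) le_rfl)
  rw [norm_mul, he₂, mul_one, show (1 - (x : ℂ)) = (((1 - x : ℝ)) : ℂ) by push_cast; ring, Complex.norm_real, Real.norm_eq_abs,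
    abs_of_nonneg (by linarith)]

/-- **The antisymmetric kink pair of DERIVATIVES is pole-free:** for every real `u`,
`‖G'(u+½)·e^{−iπβ/2} − G'(u)·e^{iπβ/2}‖ ≤ (πa + ‖e^{iπβ} − 1‖)/‖1 − zq‖` — each of the two exponential branches contributes a difference of two nearby
phases/amplitudes (`1 − e^{−πa} ≤ πa`, `‖e^{−iπβ/2} − e^{iπβ/2}‖ = ‖e^{iπβ} − 1‖`), never the bare `1/‖1 − zq‖`. [cite: Drazin2002, §8.3 (8.36)–(8.38)] -/
theorem norm_blochKernelDeriv_pair_sub_le (ha : 0 < a) (β : ℝ) {K' G' : ℝ → ℂ}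
    (hK' : K' = fun r : ℝ => ((Real.exp (-(2 * Real.pi * a * r)) : ℂ) /
            (1 - starRingEnd ℂ (Complex.exp (2 * Real.pi * β * Complex.I)) * (Real.exp (-(2 * Real.pi * a)) : ℂ))
          - (Real.exp (2 * Real.pi * a * (r - 1)) : ℂ) * Complex.exp (2 * Real.pi * β * Complex.I) /
            (1 - Complex.exp (2 * Real.pi * β * Complex.I) * (Real.exp (-(2 * Real.pi * a)) : ℂ))) / 2)
    (hG' : ∀ u : ℝ, G' u = Complex.exp (2 * Real.pi * β * (⌊u⌋ : ℝ) * Complex.I) * K' (u - ⌊u⌋)) (u : ℝ) :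
    ‖G' (u + 1 / 2) * Complex.exp (-((Real.pi * β / 2 : ℝ) : ℂ) * Complex.I) - G' u * Complex.exp (((Real.pi * β / 2 : ℝ) : ℂ) * Complex.I)‖ ≤
      (Real.pi * a + ‖Complex.exp (((Real.pi * β : ℝ) : ℂ) * Complex.I) - 1‖) /
        ‖1 - Complex.exp (2 * Real.pi * β * Complex.I) * (Real.exp (-(2 * Real.pi * a)) : ℂ)‖ := by
  set z : ℂ := Complex.exp (2 * Real.pi * β * Complex.I) with hz
  set Q : ℂ := ((Real.exp (-(2 * Real.pi * a)) : ℝ) : ℂ) with hQ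
  set N₁ : ℝ := ‖1 - z * Q‖ with hN₁
  set ep : ℂ := Complex.exp (((Real.pi * β / 2 : ℝ) : ℂ) * Complex.I) with hep
  set em : ℂ := Complex.exp (-((Real.pi * β / 2 : ℝ) : ℂ) * Complex.I) with hem
  set s₁ : ℝ := ‖Complex.exp (((Real.pi * β : ℝ) : ℂ) * Complex.I) - 1‖ with hs₁
  set κ : ℝ := 2 * Real.pi * a with hκ
  have hπ := Real.pi_pos
  have hκ0 : 0 < κ := by positivity
  have hzn : ‖z‖ = 1 := by
    rw [hz, show (2 * Real.pi * β * Complex.I : ℂ) = ((2 * Real.pi * β : ℝ) : ℂ) * Complex.I by push_cast; ring]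
    exact Complex.norm_exp_ofReal_mul_I _
  have hepn : ‖ep‖ = 1 := Complex.norm_exp_ofReal_mul_I _
  have hemn : ‖em‖ = 1 := by
    rw [hem, show -((Real.pi * β / 2 : ℝ) : ℂ) * Complex.I = ((-(Real.pi * β / 2) : ℝ) : ℂ) * Complex.I by push_cast; ring]
    exact Complex.norm_exp_ofReal_mul_I _
  have hD1 : ‖1 - starRingEnd ℂ z * Q‖ = N₁ := norm_one_sub_conj_mul z _
  have hN0 : 0 ≤ N₁ := norm_nonneg _
  -- the two phase differences are both `s₁`
  have hdiff1 : ‖em - ep‖ = s₁ := by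
    have hemE : em * Complex.exp (((Real.pi * β : ℝ) : ℂ) * Complex.I) = ep := by
      rw [hem, hep, ← Complex.exp_add]; congr 1; push_cast; ring
    have e : em - ep = -em * (Complex.exp (((Real.pi * β : ℝ) : ℂ) * Complex.I) - 1) := by rw [← hemE]; ring
    rw [e, norm_mul, norm_neg, hemn, one_mul]
  have hzem : z * em = Complex.exp (((Real.pi * β : ℝ) : ℂ) * Complex.I) * ep := by
    rw [hz, hem, hep, ← Complex.exp_add, ← Complex.exp_add]; congr 1; push_cast; ring
  have hdiff2 : ‖z * em - ep‖ = s₁ := by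
    rw [hzem, show Complex.exp (((Real.pi * β : ℝ) : ℂ) * Complex.I) * ep - ep = (Complex.exp (((Real.pi * β : ℝ) : ℂ) * Complex.I) - 1) * ep by ring,
      norm_mul, hepn, mul_one]
  -- exponential amplitude facts
  have hhalf : 1 - Real.exp (-(κ / 2)) ≤ Real.pi * a := by
    have := Real.add_one_le_exp (-(κ / 2)); rw [hκ] at this ⊢; linarith
  -- floor bookkeeping
  set n : ℤ := ⌊u⌋ with hn
  set r : ℝ := u - n with hr
  have hr0 : 0 ≤ r := by rw [hr]; linarith [Int.floor_le u]
  have hr1 : r < 1 := by rw [hr]; linarith [Int.lt_floor_add_one u]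
  have hPn : ‖Complex.exp (2 * Real.pi * β * (n : ℝ) * Complex.I)‖ = 1 := by
    rw [show (2 * Real.pi * β * (n : ℝ) * Complex.I : ℂ) = ((2 * Real.pi * β * n : ℝ) : ℂ) * Complex.I by push_cast; ring]
    exact Complex.norm_exp_ofReal_mul_I _
  -- values of `K'`
  have hK'v : ∀ t : ℝ, K' t = (((Real.exp (-(κ * t)) : ℝ) : ℂ) / (1 - starRingEnd ℂ z * Q) - ((Real.exp (κ * (t - 1)) : ℝ) : ℂ) * z / (1 - z * Q)) / 2 := by
    intro t; rw [hK']
  -- generic estimate for a combination `(A/D1 − B z/D2)/2`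
  have hcomb : ∀ A B : ℂ, ‖(A / (1 - starRingEnd ℂ z * Q) - B * z / (1 - z * Q)) / 2‖ ≤ (‖A‖ + ‖B‖) / N₁ / 2 := by
    intro A B
    rw [norm_div, show ‖(2 : ℂ)‖ = 2 by norm_num]
    gcongr
    refine (norm_sub_le _ _).trans ?_
    rw [norm_div, norm_div, norm_mul, hzn, mul_one, hD1, ← hN₁, ← add_div]
  rcases lt_or_ge r (1 / 2) with hlt | hge
  · -- Case A: `⌊u + ½⌋ = n`
    have hfl : ⌊u + 1 / 2⌋ = n := Int.floor_eq_iff.2 ⟨by linarith [Int.floor_le u], by linarith⟩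
    have hGu : G' u = Complex.exp (2 * Real.pi * β * (n : ℝ) * Complex.I) * K' r := by rw [hG' u]
    have hGh : G' (u + 1 / 2) = Complex.exp (2 * Real.pi * β * (n : ℝ) * Complex.I) * K' (r + 1 / 2) := by
      rw [hG' (u + 1 / 2), hfl]; congr 1; rw [hr]; ring
    have e0 : Complex.exp (2 * Real.pi * β * (n : ℝ) * Complex.I) * K' (r + 1 / 2) * em - Complex.exp (2 * Real.pi * β * (n : ℝ) * Complex.I) * K' r * ep =
        Complex.exp (2 * Real.pi * β * (n : ℝ) * Complex.I) * (K' (r + 1 / 2) * em - K' r * ep) := by ring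
    rw [hGu, hGh, e0, norm_mul, hPn, one_mul, hK'v, hK'v]
    -- regroup into the `A`/`B` form
    have e : (((Real.exp (-(κ * (r + 1 / 2))) : ℝ) : ℂ) / (1 - starRingEnd ℂ z * Q) - ((Real.exp (κ * (r + 1 / 2 - 1)) : ℝ) : ℂ) * z / (1 - z * Q)) / 2 * em -
          (((Real.exp (-(κ * r)) : ℝ) : ℂ) / (1 - starRingEnd ℂ z * Q) - ((Real.exp (κ * (r - 1)) : ℝ) : ℂ) * z / (1 - z * Q)) / 2 * ep =
        ((((Real.exp (-(κ * (r + 1 / 2))) : ℝ) : ℂ) * em - ((Real.exp (-(κ * r)) : ℝ) : ℂ) * ep) / (1 - starRingEnd ℂ z * Q) -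
          (((Real.exp (κ * (r + 1 / 2 - 1)) : ℝ) : ℂ) * em - ((Real.exp (κ * (r - 1)) : ℝ) : ℂ) * ep) * z / (1 - z * Q)) / 2 := by ring
    rw [e]
    refine (hcomb _ _).trans ?_
    -- the two differences
    have hT1 : ‖((Real.exp (-(κ * (r + 1 / 2))) : ℝ) : ℂ) * em - ((Real.exp (-(κ * r)) : ℝ) : ℂ) * ep‖ ≤ Real.pi * a + s₁ := by
      have f : ((Real.exp (-(κ * (r + 1 / 2))) : ℝ) : ℂ) * em - ((Real.exp (-(κ * r)) : ℝ) : ℂ) * ep =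
          ((Real.exp (-(κ * r)) : ℝ) : ℂ) * ((((Real.exp (-(κ / 2))) : ℝ) : ℂ) * em - ep) := by
        rw [show -(κ * (r + 1 / 2)) = -(κ * r) + -(κ / 2) by ring, Real.exp_add]; push_cast; ring
      rw [f, norm_mul, Complex.norm_real, Real.norm_eq_abs, abs_of_pos (Real.exp_pos _)]
      have hx1 : Real.exp (-(κ * r)) ≤ 1 := by rw [Real.exp_le_one_iff]; nlinarith
      have hy1 : Real.exp (-(κ / 2)) ≤ 1 := by rw [Real.exp_le_one_iff]; linarith
      calc Real.exp (-(κ * r)) * ‖(((Real.exp (-(κ / 2))) : ℝ) : ℂ) * em - ep‖ ≤ 1 * ((1 - Real.exp (-(κ / 2))) + ‖em - ep‖) :=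
            mul_le_mul hx1 (norm_smul_unit_sub_le hy1 hemn) (norm_nonneg _) zero_le_one
        _ ≤ Real.pi * a + s₁ := by rw [one_mul, hdiff1]; linarith
    have hT2 : ‖((Real.exp (κ * (r + 1 / 2 - 1)) : ℝ) : ℂ) * em - ((Real.exp (κ * (r - 1)) : ℝ) : ℂ) * ep‖ ≤ Real.pi * a + s₁ := by
      -- `= e^{κ(r−½)}·(em − e^{−κ/2} ep)`, and `e^{κ(r−½)} ≤ 1`
      have f : ((Real.exp (κ * (r + 1 / 2 - 1)) : ℝ) : ℂ) * em - ((Real.exp (κ * (r - 1)) : ℝ) : ℂ) * ep =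
          ((Real.exp (κ * (r - 1 / 2)) : ℝ) : ℂ) * (em - (((Real.exp (-(κ / 2))) : ℝ) : ℂ) * ep) := by
        rw [show κ * (r - 1) = κ * (r - 1 / 2) + -(κ / 2) by ring, Real.exp_add, show κ * (r + 1 / 2 - 1) = κ * (r - 1 / 2) by ring]
        push_cast; ring
      rw [f, norm_mul, Complex.norm_real, Real.norm_eq_abs, abs_of_pos (Real.exp_pos _)]
      have hx1 : Real.exp (κ * (r - 1 / 2)) ≤ 1 := by rw [Real.exp_le_one_iff]; nlinarith
      have hy1 : Real.exp (-(κ / 2)) ≤ 1 := by rw [Real.exp_le_one_iff]; linarith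
      calc Real.exp (κ * (r - 1 / 2)) * ‖em - (((Real.exp (-(κ / 2))) : ℝ) : ℂ) * ep‖ ≤ 1 * ((1 - Real.exp (-(κ / 2))) + ‖em - ep‖) :=
            mul_le_mul hx1 (norm_unit_sub_smul_le hy1 hepn) (norm_nonneg _) zero_le_one
        _ ≤ Real.pi * a + s₁ := by rw [one_mul, hdiff1]; linarith
    calc (‖((Real.exp (-(κ * (r + 1 / 2))) : ℝ) : ℂ) * em - ((Real.exp (-(κ * r)) : ℝ) : ℂ) * ep‖ +
            ‖((Real.exp (κ * (r + 1 / 2 - 1)) : ℝ) : ℂ) * em - ((Real.exp (κ * (r - 1)) : ℝ) : ℂ) * ep‖) / N₁ / 2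
        ≤ ((Real.pi * a + s₁) + (Real.pi * a + s₁)) / N₁ / 2 := by gcongr
      _ = (Real.pi * a + s₁) / N₁ := by ring
  · -- Case B: `⌊u + ½⌋ = n + 1`
    have hfl : ⌊u + 1 / 2⌋ = n + 1 := Int.floor_eq_iff.2 ⟨by push_cast; linarith, by push_cast; linarith [Int.lt_floor_add_one u]⟩
    have hGu : G' u = Complex.exp (2 * Real.pi * β * (n : ℝ) * Complex.I) * K' r := by rw [hG' u]
    have hGh : G' (u + 1 / 2) = Complex.exp (2 * Real.pi * β * (n : ℝ) * Complex.I) * (z * K' (r - 1 / 2)) := by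
      rw [hG' (u + 1 / 2), hfl, ← mul_assoc, hz, ← Complex.exp_add]
      congr 1
      · congr 1; push_cast; ring
      · congr 1; rw [hr]; push_cast; ring
    have e0 : Complex.exp (2 * Real.pi * β * (n : ℝ) * Complex.I) * (z * K' (r - 1 / 2)) * em -
          Complex.exp (2 * Real.pi * β * (n : ℝ) * Complex.I) * K' r * ep =
        Complex.exp (2 * Real.pi * β * (n : ℝ) * Complex.I) * (z * K' (r - 1 / 2) * em - K' r * ep) := by ring
    rw [hGu, hGh, e0, norm_mul, hPn, one_mul, hK'v, hK'v]
    have e : z * ((((Real.exp (-(κ * (r - 1 / 2))) : ℝ) : ℂ) / (1 - starRingEnd ℂ z * Q) - ((Real.exp (κ * (r - 1 / 2 - 1)) : ℝ) : ℂ) * z / (1 - z * Q)) / 2) * em -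
          (((Real.exp (-(κ * r)) : ℝ) : ℂ) / (1 - starRingEnd ℂ z * Q) - ((Real.exp (κ * (r - 1)) : ℝ) : ℂ) * z / (1 - z * Q)) / 2 * ep =
        ((((Real.exp (-(κ * (r - 1 / 2))) : ℝ) : ℂ) * (z * em) - ((Real.exp (-(κ * r)) : ℝ) : ℂ) * ep) / (1 - starRingEnd ℂ z * Q) -
          (((Real.exp (κ * (r - 1 / 2 - 1)) : ℝ) : ℂ) * (z * em) - ((Real.exp (κ * (r - 1)) : ℝ) : ℂ) * ep) * z / (1 - z * Q)) / 2 := by ring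
    rw [e]
    refine (hcomb _ _).trans ?_
    have hzemn : ‖z * em‖ = 1 := by rw [norm_mul, hzn, hemn, one_mul]
    have hT1 : ‖((Real.exp (-(κ * (r - 1 / 2))) : ℝ) : ℂ) * (z * em) - ((Real.exp (-(κ * r)) : ℝ) : ℂ) * ep‖ ≤ Real.pi * a + s₁ := by
      -- `= e^{κ(½−r)}·((z em) − e^{−κ/2} ep)`... written as `e^{-κ r}·(e^{κ/2}(z em) − ep)`; use `e^{κ(½−r)} ≤ 1`
      have f : ((Real.exp (-(κ * (r - 1 / 2))) : ℝ) : ℂ) * (z * em) - ((Real.exp (-(κ * r)) : ℝ) : ℂ) * ep =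
          ((Real.exp (κ * (1 / 2 - r)) : ℝ) : ℂ) * ((z * em) - (((Real.exp (-(κ / 2))) : ℝ) : ℂ) * ep) := by
        rw [show -(κ * r) = κ * (1 / 2 - r) + -(κ / 2) by ring, Real.exp_add, show -(κ * (r - 1 / 2)) = κ * (1 / 2 - r) by ring]
        push_cast; ring
      rw [f, norm_mul, Complex.norm_real, Real.norm_eq_abs, abs_of_pos (Real.exp_pos _)]
      have hx1 : Real.exp (κ * (1 / 2 - r)) ≤ 1 := by rw [Real.exp_le_one_iff]; nlinarith
      have hy1 : Real.exp (-(κ / 2)) ≤ 1 := by rw [Real.exp_le_one_iff]; linarith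
      calc Real.exp (κ * (1 / 2 - r)) * ‖z * em - (((Real.exp (-(κ / 2))) : ℝ) : ℂ) * ep‖ ≤ 1 * ((1 - Real.exp (-(κ / 2))) + ‖z * em - ep‖) :=
            mul_le_mul hx1 (norm_unit_sub_smul_le hy1 hepn) (norm_nonneg _) zero_le_one
        _ ≤ Real.pi * a + s₁ := by rw [one_mul, hdiff2]; linarith
    have hT2 : ‖((Real.exp (κ * (r - 1 / 2 - 1)) : ℝ) : ℂ) * (z * em) - ((Real.exp (κ * (r - 1)) : ℝ) : ℂ) * ep‖ ≤ Real.pi * a + s₁ := by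
      have f : ((Real.exp (κ * (r - 1 / 2 - 1)) : ℝ) : ℂ) * (z * em) - ((Real.exp (κ * (r - 1)) : ℝ) : ℂ) * ep =
          ((Real.exp (κ * (r - 1)) : ℝ) : ℂ) * ((((Real.exp (-(κ / 2))) : ℝ) : ℂ) * (z * em) - ep) := by
        rw [show κ * (r - 1 / 2 - 1) = κ * (r - 1) + -(κ / 2) by ring, Real.exp_add]; push_cast; ring
      rw [f, norm_mul, Complex.norm_real, Real.norm_eq_abs, abs_of_pos (Real.exp_pos _)]
      have hx1 : Real.exp (κ * (r - 1)) ≤ 1 := by rw [Real.exp_le_one_iff]; nlinarith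
      have hy1 : Real.exp (-(κ / 2)) ≤ 1 := by rw [Real.exp_le_one_iff]; linarith
      calc Real.exp (κ * (r - 1)) * ‖(((Real.exp (-(κ / 2))) : ℝ) : ℂ) * (z * em) - ep‖ ≤ 1 * ((1 - Real.exp (-(κ / 2))) + ‖z * em - ep‖) :=
            mul_le_mul hx1 (norm_smul_unit_sub_le hy1 hzemn) (norm_nonneg _) zero_le_one
        _ ≤ Real.pi * a + s₁ := by rw [one_mul, hdiff2]; linarith
    calc (‖((Real.exp (-(κ * (r - 1 / 2))) : ℝ) : ℂ) * (z * em) - ((Real.exp (-(κ * r)) : ℝ) : ℂ) * ep‖ +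
            ‖((Real.exp (κ * (r - 1 / 2 - 1)) : ℝ) : ℂ) * (z * em) - ((Real.exp (κ * (r - 1)) : ℝ) : ℂ) * ep‖) / N₁ / 2
        ≤ ((Real.pi * a + s₁) + (Real.pi * a + s₁)) / N₁ / 2 := by gcongr
      _ = (Real.pi * a + s₁) / N₁ := by ring

end kernelDeriv

end Summit.AnomalousDissipation.AnomalousDissipation.Theorems.SawtoothPulseCascade.K2PhaseBudget

end
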